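import Mathlib
import HarnessLib

/-!
# Route `RadicialJung`, crux `CleanModels` (stmt-ResolutionOfSingularities-15917), line `Sketch` rev 35, stub 6 `stub_cleanProp44` (X44c):
# THE CONSTANT-TYPE BIRTH WITNESS — `F = 1 + a·u^p`, `a ∉ κ^p`: `F′ = 0` and `ν = p` exactly (the corner (B5′) of memo 4e §2.6 (d), in kernel)

Seat decomp-res-hand-2 g20 (structural hand).  Memo 4e §2.6 (d): «THE CORNER: `λ′ ≡ 0`, i.e. `λ ∈ κ(c)[u^p]` but `F = −v(c)λ ∉ κ(c)^p[u^p]` … «CONSTANT-TYPE births»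
… there `ν(c′)` can be as large as `δ` (example: `F = 1 + a u^p`, `a ∉ κ^p`, at `u = 0`: `ν = p = δ`) and the degree count says nothing».  This file is that example as a
kernel statement, so that the hypothesis `D F ≠ 0` of ✓ `sum_mul_natDegree_le_of_add_pow_mem` (`…CleanProp44BirthCount`) and the bound `ν ≤ δ − 1` of the perfect case
are seen to be SHARP: over a field `κ` of characteristic `p` with an element `a` that is not a `p`-th power,

* `derivative_one_add_C_mul_X_pow_char` — `F′ = 0` for `F = 1 + a·u^p` (the coordinate derivation is blind);
* `one_add_C_mul_X_pow_sub_pow_not_mem` — for EVERY `G ∈ κ[u]`: `F − G^p ∉ (u)^{p+1}` («`ν ≤ p`»);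
* `one_add_C_mul_X_pow_sub_one_pow_mem` — `F − 1^p ∈ (u)^p` («`ν ≥ p`»): so `ν = p = deg F = δ` at the rational point `u = 0`, a constant-type birth with NO descent
  from the degree count.

Honest framing: OURS, an elementary witness recording why (B5′) (imperfect residue fields) is outside the reach of the typed counting engine; nothing here proves or
refutes X44c, any case of `CleanModels`, or resolution of singularities in characteristic `p`. [cite: CossartPiltant2008, Prop. 4.4 (proof, p. 11)]
-/

noncomputable section

set_option linter.dupNamespace false -- mandated namespace of this single-conjunct summit

open Polynomial

namespace Summit.ResolutionOfSingularities.ResolutionOfSingularities.Theorems.RadicialJung.CleanModels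

variable {k : Type*} [Field k] (p : ℕ)

/-- **`ν ≥ p`**: `F − 1^p = a·u^p ∈ (u)^p`. [folklore] -/
theorem one_add_C_mul_X_pow_sub_one_pow_mem (a : k) : (1 + C a * X ^ p : k[X]) - 1 ^ p ∈ Ideal.span {(X : k[X])} ^ p := by
  rw [one_pow, add_sub_cancel_left, Ideal.span_singleton_pow, Ideal.mem_span_singleton]
  exact Dvd.intro_left _ rfl

variable [hp : Fact p.Prime] [CharP k p]

omit hp in
/-- `F = 1 + a·u^p` has `F′ = 0` in characteristic `p`. [folklore] -/
theorem derivative_one_add_C_mul_X_pow_char (a : k) : derivative (1 + C a * X ^ p : k[X]) = 0 := by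
  rw [derivative_add, derivative_one, derivative_C_mul_X_pow, CharP.cast_eq_zero]
  simp

/-- **`ν ≤ p`**: if `a` is not a `p`-th power in `κ`, then for EVERY `G ∈ κ[u]`, `F − G^p ∉ (u)^{p+1}` (`F = 1 + a·u^p`).  Writing `G = G(0) + u·H`:
`F − G^p = (1 − G(0)^p) + u^p·(a − H^p)`; if `G(0)^p ≠ 1` the order is `0`; otherwise it is `p + ord(a − H^p) = p` since `a − H(0)^p ≠ 0`.
[cite: CossartPiltant2008, Prop. 4.4 (proof, p. 11)] -/
theorem one_add_C_mul_X_pow_sub_pow_not_mem {a : k} (ha : ∀ b : k, b ^ p ≠ a) (G : k[X]) :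
    (1 + C a * X ^ p : k[X]) - G ^ p ∉ Ideal.span {(X : k[X])} ^ (p + 1) := by
  intro hmem
  rw [Ideal.span_singleton_pow, Ideal.mem_span_singleton] at hmem
  -- `G = C c₀ + X * H`
  obtain ⟨c₀, H, hH⟩ : ∃ (c₀ : k) (H : k[X]), G = C c₀ + X * H := by
    refine ⟨G.coeff 0, G.divX, ?_⟩
    have h := G.divX_mul_X_add
    rw [mul_comm] at h
    rw [add_comm]; exact h.symm
  have hGp : G ^ p = C (c₀ ^ p) + X ^ p * H ^ p := by
    rw [hH, add_pow_char, ← C_pow, mul_pow]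
  have hkey : (1 + C a * X ^ p : k[X]) - G ^ p = C (1 - c₀ ^ p) + X ^ p * (C a - H ^ p) := by
    rw [hGp, C_sub, C_1]; ring
  rw [hkey] at hmem
  -- the constant coefficient vanishes: `1 − c₀^p = 0`
  have hX1 : (X : k[X]) ∣ C (1 - c₀ ^ p) + X ^ p * (C a - H ^ p) :=
    dvd_trans (dvd_pow_self X (Nat.succ_ne_zero p)) hmem
  have h0 : (1 : k) - c₀ ^ p = 0 := by
    have h1 := X_dvd_iff.mp hX1
    rw [coeff_add, coeff_C_zero, coeff_X_pow_mul', if_neg (by have := hp.out.pos; omega), add_zero] at h1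
    exact h1
  rw [h0, C_0, zero_add, pow_succ] at hmem
  -- cancel `X^p`: `X ∣ C a − H^p`, i.e. `a = H(0)^p`
  have h2 : (X : k[X]) ∣ C a - H ^ p := (mul_dvd_mul_iff_left (pow_ne_zero p X_ne_zero)).mp hmem
  have h4 : (C a - H ^ p).coeff 0 = 0 := X_dvd_iff.mp h2
  rw [coeff_sub, coeff_C_zero, coeff_zero_eq_eval_zero, eval_pow, ← coeff_zero_eq_eval_zero] at h4
  exact ha (H.coeff 0) (sub_eq_zero.mp h4).symm

end Summit.ResolutionOfSingularities.ResolutionOfSingularities.Theorems.RadicialJung.CleanModels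

end
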